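import Literature.NumberTheory.PAdicHodge.SenDecompletionRankOne
import Mathlib.LinearAlgebra.Matrix.NonsingularInverse
import Mathlib.Topology.Instances.Matrix
import HarnessLib

/-!
# Sen–Tate decompletion for `GL_d` over the cyclotomic tower: the contraction step and the
# decompletion of small cocycles (Berger–Colmez, Lemme 3.2.3 and Cor. 3.2.4)

Notation as in `SenDecompletionRankOne`: `K₀ = PadicBase F p hp ≅ ℚ_p`, `ℂ_F = CompletedAlgClosure F`,
`X = \widehat{K_∞} ⊆ ℂ_F` (a closed subfield), `K n = K₀(ζ_{pⁿ})`, `γ = γ_n = TateTrace.gen n` (`n ≥ 2`),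
`R_n = TateTrace.Rhat n` Tate's normalised trace, `π = ‖p‖`. Matrices are indexed by a finite type `m`
(`d = #m`); we measure a matrix by the sup of the norms of its entries (all bounds below are stated
entrywise, `∀ i j, ‖M i j‖ ≤ r`, which over the ultrametric field `ℂ_F` is submultiplicative:
`private norm_mul_apply_le`), and `γ` acts on matrices entrywise, `M ↦ M.map (γ • ·)`.

## Main results

* `TateTrace.exists_conj_near_fixed_matrix` — **the contraction step (Berger–Colmez Lemme 3.2.3, for the
  cyclotomic tower `Λ̃ = ℂ_F`, `H = H_{K₀}`).** Let `U ∈ M_d(X)` and let `Rr ∈ M_d(X)^{γ=1}` with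
  `‖Rr‖ ≤ M`, `‖U − 1 − Rr‖ ≤ E`, `‖p‖⁻¹E ≤ M`, `‖p‖⁻³E < 1`. Then there is `C ∈ M_d(X)` with
  `‖C‖ ≤ ‖p‖⁻³E` and a `γ`-fixed `Rr' ∈ M_d(X)` with `‖Rr'‖ ≤ M`, `‖Rr' − Rr‖ ≤ ‖p‖⁻¹E`, such that
  `U' = (1 + C)⁻¹ · U · γ(1 + C) ∈ M_d(X)` satisfies `‖U' − 1 − Rr'‖ ≤ ‖p‖⁻³ M E`.
* ★ `TateTrace.exists_matrix_conj_fixed` — **decompletion of small cocycles (Berger–Colmez Cor. 3.2.4,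
  cyclotomic tower).** For `U ∈ M_d(X)` with `‖U − 1‖ ≤ ‖p‖⁷` (entrywise) there is `B ∈ M_d(X)` with
  `‖B − 1‖ ≤ ‖p‖² < 1`, `det B` a unit and `B⁻¹ ∈ M_d(X)` (so `B ∈ GL_d(X)`), such that
  `B⁻¹ · U · γ(B) ∈ M_d(X)` is FIXED by `γ` entrywise — hence (`TateTrace.mem_image_K_of_gen_smul_eq`)
  has entries in `K n` (`TateTrace.exists_matrix_K_mul_eq`: `U γ(B) = B W`, `W ∈ M_d(K_n)`): the value
  at `γ_n` of a `1`-cocycle with values in `GL_d(\widehat{K_∞})` that is `‖p‖⁷`-close to `1` is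
  cohomologous to a `GL_d(K_n)`-valued one. This is the decompletion half of Sen's theorem
  `H¹(Γ_K, GL_d(\widehat{K_∞})) = H¹(Γ_K, GL_d(K_∞))`.

## Proof

Word for word the rank-one argument of `SenDecompletionRankOne` (Berger–Colmez Lemme 3.2.3 with
Colmez's constants `c₂ = 1`, `c₃ = 2` supplied by Tate's Prop. 6 / Prop. 7: tree `TateTrace.norm_Rhat_le`,
`TateTrace.norm_sub_Rhat_le`, `TateTrace.exists_gen_smul_sub_eq_of_Rhat_eq_zero`), with the order of
factors respected: for `V = U − 1`, `W = V − Rr`, `Rr' = Rr + R_n(W)`, `V₁ = W − R_n(W)` and `C` solving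
`γC − C = −V₁` entrywise,

  `(1 + C) · (U' − 1 − Rr') = V·γ(C) − C·Rr'`,  `U' = (1 + C)⁻¹ U γ(1 + C)`

(a noncommutative polynomial identity, `noncomm_ring`). The matrix `1 + C`, `‖C‖ < 1`, is invertible
with `‖det(1 + C) − 1‖ < 1` and `‖(1 + C)⁻¹‖ ≤ 1` (Leibniz expansion; adjugate formula), and its inverse
has entries in the subfield `X`. The iteration `B_{k+1} = B_k(1 + C_k)` converges entrywise in the
complete field `ℂ_F`; `Rr_k` converges too (`‖Rr_{k+1} − Rr_k‖ ≤ ‖p‖⁻¹E_k`), so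
`U_k = B_k⁻¹ U γ(B_k) → 1 + Rr_∞`, and passing to the limit in `B_k U_k = U γ(B_k)` (no inverse needed)
gives `B (1 + Rr_∞) = U γ(B)` with `B` invertible and `1 + Rr_∞` fixed by `γ`. No named facts are used.

References: L. Berger, P. Colmez, *Familles de représentations de de Rham et monodromie p-adique*,
Astérisque 319 (2008), §3.2, Lemme 3.2.3 and Cor. 3.2.4 [BergerColmez2008]; J. Tate, *p-divisible
groups* (1967), §3.2 Prop. 7 [Tate1967]; S. Sen, Invent. Math. 62 (1980) [Sen1980] (original source, not
consulted).
-/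

noncomputable section

open ValuativeRel Field UniformSpace Filter Topology Finset

open scoped IntermediateField

namespace Literature.NumberTheory.PAdicHodge

open Literature.NumberTheory.GaloisRepresentations
open Literature.NumberTheory.GaloisRepresentations.IsNonarchimedeanLocalField
open CyclotomicTower

variable {F : Type} [Field F] [ValuativeRel F] [TopologicalSpace F] [IsNonarchimedeanLocalField F]
  [CharZero F] {p : ℕ} [Fact p.Prime] (hp : valuation F p < 1)

namespace TateTrace

variable {m : Type} [Fintype m] [DecidableEq m]

/-! ### Ultrametric matrix toolkit over `ℂ_F` -/

omit [CharZero F] in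
/-- `‖x + y‖ ≤ max ‖x‖ ‖y‖` in `ℂ_F`. [folklore] -/
private theorem norm_add_le_max' (x y : CompletedAlgClosure F) : ‖x + y‖ ≤ max ‖x‖ ‖y‖ :=
  IsUltrametricDist.norm_add_le_max x y

omit [CharZero F] in
/-- `‖x - y‖ ≤ max ‖x‖ ‖y‖` in `ℂ_F`. [folklore] -/
private theorem norm_sub_le_max' (x y : CompletedAlgClosure F) : ‖x - y‖ ≤ max ‖x‖ ‖y‖ := by
  rw [sub_eq_add_neg, ← norm_neg y]; exact IsUltrametricDist.norm_add_le_max x (-y)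

omit [CharZero F] in
/-- `‖1 + c‖ = 1` when `‖c‖ < 1`. [folklore] -/
private theorem norm_one_add_eq {c : CompletedAlgClosure F} (hc : ‖c‖ < 1) : ‖1 + c‖ = 1 := by
  have h := IsUltrametricDist.norm_add_eq_max_of_norm_ne_norm (x := (1 : CompletedAlgClosure F)) (y := c)
    (by rw [norm_one]; exact hc.ne')
  rw [h, norm_one, max_eq_left hc.le]

omit [CharZero F] [DecidableEq m] in
/-- Entrywise bounds are submultiplicative over the ultrametric field `ℂ_F`:
`‖(A B) i j‖ ≤ (sup ‖A‖)(sup ‖B‖)`. [folklore] -/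
private theorem norm_mul_apply_le {A B : Matrix m m (CompletedAlgClosure F)} {a b : ℝ} (ha : 0 ≤ a)
    (hb : 0 ≤ b) (hA : ∀ i j, ‖A i j‖ ≤ a) (hB : ∀ i j, ‖B i j‖ ≤ b) (i j : m) :
    ‖(A * B) i j‖ ≤ a * b := by
  rw [Matrix.mul_apply]
  exact IsUltrametricDist.norm_sum_le_of_forall_le_of_nonneg (mul_nonneg ha hb)
    fun k _ => by rw [norm_mul]; exact mul_le_mul (hA i k) (hB k j) (norm_nonneg _) ha

omit [CharZero F] [Fintype m] [DecidableEq m] in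
/-- `‖(A - B) i j‖ ≤ max`. [folklore] -/
private theorem norm_sub_apply_le {A B : Matrix m m (CompletedAlgClosure F)} {a b : ℝ}
    (hA : ∀ i j, ‖A i j‖ ≤ a) (hB : ∀ i j, ‖B i j‖ ≤ b) (i j : m) :
    ‖(A - B) i j‖ ≤ max a b := by
  rw [Matrix.sub_apply]
  exact (norm_sub_le_max' _ _).trans (max_le_max (hA i j) (hB i j))

omit [CharZero F] [Fintype m] [DecidableEq m] in
/-- `‖(A + B) i j‖ ≤ max`. [folklore] -/
private theorem norm_add_apply_le {A B : Matrix m m (CompletedAlgClosure F)} {a b : ℝ}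
    (hA : ∀ i j, ‖A i j‖ ≤ a) (hB : ∀ i j, ‖B i j‖ ≤ b) (i j : m) :
    ‖(A + B) i j‖ ≤ max a b := by
  rw [Matrix.add_apply]
  exact (norm_add_le_max' _ _).trans (max_le_max (hA i j) (hB i j))

omit [CharZero F] in
/-- The determinant of a matrix with entries of norm `≤ 1` has norm `≤ 1`. [folklore] -/
private theorem norm_det_le_one {A : Matrix m m (CompletedAlgClosure F)} (hA : ∀ i j, ‖A i j‖ ≤ 1) :
    ‖A.det‖ ≤ 1 := by
  rw [Matrix.det_apply']
  refine IsUltrametricDist.norm_sum_le_of_forall_le_of_nonneg zero_le_one fun σ _ => ?_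
  have h1 : ‖(((Equiv.Perm.sign σ : ℤˣ) : ℤ) : CompletedAlgClosure F)‖ = 1 := by
    rcases Int.units_eq_one_or (Equiv.Perm.sign σ) with h | h <;> simp [h]
  rw [norm_mul, h1, one_mul, norm_prod]
  exact Finset.prod_le_one (fun i _ => norm_nonneg _) fun i _ => hA _ _

omit [CharZero F] [Fintype m] in
/-- Entries of `1 + C`, `‖C‖ ≤ r ≤ 1`: norm `≤ 1`, and the off-diagonal ones `≤ r`. [folklore] -/
private theorem norm_one_add_apply_le {C : Matrix m m (CompletedAlgClosure F)} {r : ℝ} (hr1 : r ≤ 1)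
    (hC : ∀ i j, ‖C i j‖ ≤ r) (i j : m) :
    ‖(1 + C : Matrix m m (CompletedAlgClosure F)) i j‖ ≤ 1 ∧
      (i ≠ j → ‖(1 + C : Matrix m m (CompletedAlgClosure F)) i j‖ ≤ r) := by
  rw [Matrix.add_apply]
  by_cases hij : i = j
  · subst hij
    rw [Matrix.one_apply_eq]
    refine ⟨(norm_add_le_max' _ _).trans ?_, fun h => (h rfl).elim⟩
    rw [norm_one]; exact max_le le_rfl ((hC i i).trans hr1)
  · rw [Matrix.one_apply_ne hij, zero_add]
    exact ⟨(hC i j).trans hr1, fun _ => hC i j⟩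

omit [CharZero F] [Fintype m] in
/-- `‖∏ (1 + c_i) − 1‖ ≤ r` when all `‖c_i‖ ≤ r ≤ 1`. [folklore] -/
private theorem norm_prod_one_add_sub_one_le {s : Finset m} {c : m → CompletedAlgClosure F} {r : ℝ}
    (hr0 : 0 ≤ r) (hr1 : r ≤ 1) (hc : ∀ i, ‖c i‖ ≤ r) : ‖∏ i ∈ s, (1 + c i) - 1‖ ≤ r := by
  induction s using Finset.induction_on with
  | empty => rw [Finset.prod_empty, sub_self, norm_zero]; exact hr0
  | @insert a s ha ih =>
    rw [Finset.prod_insert ha]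
    set P := ∏ i ∈ s, (1 + c i)
    have hP : ‖P‖ ≤ 1 := by
      have h := norm_add_le_max' (P - 1) 1
      rw [sub_add_cancel, norm_one] at h
      exact h.trans (max_le (ih.trans hr1) le_rfl)
    have h : (1 + c a) * P - 1 = (P - 1) + c a * P := by ring
    rw [h]
    refine (norm_add_le_max' _ _).trans (max_le ih ?_)
    rw [norm_mul]
    calc ‖c a‖ * ‖P‖ ≤ r * 1 := mul_le_mul (hc a) hP (norm_nonneg _) hr0
      _ = r := mul_one r

omit [CharZero F] in
/-- **`‖det(1 + C) − 1‖ ≤ ‖C‖` for `‖C‖ < 1`** (Leibniz expansion: the diagonal term is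
`∏(1 + C_ii)`, every other term has an off-diagonal factor). [folklore] -/
private theorem norm_det_one_add_sub_one_le {C : Matrix m m (CompletedAlgClosure F)} {r : ℝ}
    (hr0 : 0 ≤ r) (hr1 : r < 1) (hC : ∀ i j, ‖C i j‖ ≤ r) :
    ‖(1 + C : Matrix m m (CompletedAlgClosure F)).det - 1‖ ≤ r := by
  have hent := norm_one_add_apply_le hr1.le hC
  rw [Matrix.det_apply', ← Finset.sum_erase_add _ _ (Finset.mem_univ (1 : Equiv.Perm m))]
  simp only [Equiv.Perm.sign_one, Units.val_one, Int.cast_one, one_mul, Equiv.Perm.one_apply]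
  rw [add_sub_assoc]
  refine (norm_add_le_max' _ _).trans (max_le ?_ ?_)
  · refine IsUltrametricDist.norm_sum_le_of_forall_le_of_nonneg hr0 fun σ hσ => ?_
    have hσ1 : σ ≠ 1 := Finset.ne_of_mem_erase hσ
    obtain ⟨i₀, hi₀⟩ : ∃ i, σ i ≠ i := not_forall.mp fun h => hσ1 (Equiv.ext h)
    have h1 : ‖(((Equiv.Perm.sign σ : ℤˣ) : ℤ) : CompletedAlgClosure F)‖ = 1 := by
      rcases Int.units_eq_one_or (Equiv.Perm.sign σ) with h | h <;> simp [h]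
    rw [norm_mul, h1, one_mul, ← Finset.prod_erase_mul _ _ (Finset.mem_univ i₀), norm_mul]
    calc ‖∏ i ∈ Finset.univ.erase i₀, (1 + C : Matrix m m (CompletedAlgClosure F)) (σ i) i‖ *
          ‖(1 + C : Matrix m m (CompletedAlgClosure F)) (σ i₀) i₀‖ ≤ 1 * r := by
          refine mul_le_mul ?_ ((hent _ _).2 hi₀) (norm_nonneg _) zero_le_one
          rw [norm_prod]
          exact Finset.prod_le_one (fun i _ => norm_nonneg _) fun i _ => (hent _ _).1
      _ = r := one_mul r
  · simp only [Matrix.add_apply, Matrix.one_apply_eq]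
    exact norm_prod_one_add_sub_one_le hr0 hr1.le fun i => hC i i

omit [CharZero F] in
/-- **`1 + C` is invertible for `‖C‖ < 1`**, with `‖det(1 + C)‖ = 1`. [folklore] -/
private theorem norm_det_one_add_eq_one {C : Matrix m m (CompletedAlgClosure F)} {r : ℝ}
    (hr0 : 0 ≤ r) (hr1 : r < 1) (hC : ∀ i j, ‖C i j‖ ≤ r) :
    ‖(1 + C : Matrix m m (CompletedAlgClosure F)).det‖ = 1 := by
  have h := norm_det_one_add_sub_one_le hr0 hr1 hC
  have h1 : (1 + C : Matrix m m (CompletedAlgClosure F)).det =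
      1 + ((1 + C : Matrix m m (CompletedAlgClosure F)).det - 1) := by ring
  rw [h1]
  exact norm_one_add_eq (h.trans_lt hr1)

omit [CharZero F] in
/-- `B` with `‖B − 1‖ < 1` (entrywise `≤ r < 1`) has `‖det B‖ = 1`, so is invertible. [folklore] -/
private theorem isUnit_det_of_norm_sub_one_le {B : Matrix m m (CompletedAlgClosure F)} {r : ℝ}
    (hr0 : 0 ≤ r) (hr1 : r < 1) (hB : ∀ i j, ‖(B - 1) i j‖ ≤ r) : IsUnit B.det := by
  have h := norm_det_one_add_eq_one hr0 hr1 hB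
  rw [add_sub_cancel] at h
  refine isUnit_iff_ne_zero.mpr fun h0 => ?_
  rw [h0, norm_zero] at h
  exact zero_ne_one h

omit [CharZero F] in
/-- **`‖(1 + C)⁻¹‖ ≤ 1` for `‖C‖ < 1`** (adjugate formula). [folklore] -/
private theorem norm_inv_one_add_apply_le {C : Matrix m m (CompletedAlgClosure F)} {r : ℝ}
    (hr0 : 0 ≤ r) (hr1 : r < 1) (hC : ∀ i j, ‖C i j‖ ≤ r) (i j : m) :
    ‖(1 + C : Matrix m m (CompletedAlgClosure F))⁻¹ i j‖ ≤ 1 := by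
  have hdet := norm_det_one_add_eq_one hr0 hr1 hC
  have hent := norm_one_add_apply_le hr1.le hC
  rw [Matrix.inv_def, Matrix.smul_apply, smul_eq_mul, Ring.inverse_eq_inv, norm_mul, norm_inv, hdet,
    inv_one, one_mul, Matrix.adjugate_apply]
  refine norm_det_le_one fun i' j' => ?_
  rw [Matrix.updateRow_apply]
  split_ifs with h
  · by_cases hij : j' = i
    · subst hij; rw [Pi.single_eq_same, norm_one]
    · rw [Pi.single_eq_of_ne hij, norm_zero]; exact zero_le_one
  · exact (hent _ _).1

/-! ### Matrices with entries in the subfield `X` -/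

/-- `X` as a subring of `ℂ_F` (existence only; no new constant). [folklore] -/
private theorem exists_subring_coe_eq_X :
    ∃ R : Subring (CompletedAlgClosure F), (R : Set (CompletedAlgClosure F)) = X hp :=
  ⟨{ carrier := X hp
     mul_mem' := fun ha hb => mul_mem_X hp ha hb
     one_mem' := one_mem_X hp
     add_mem' := fun ha hb => add_mem_X hp ha hb
     zero_mem' := zero_mem_X hp
     neg_mem' := fun ha => neg_mem_X hp ha }, rfl⟩

omit [DecidableEq m] in
/-- Products of matrices over `X` are over `X`. [folklore] -/
private theorem mul_apply_mem_X {A B : Matrix m m (CompletedAlgClosure F)} (hA : ∀ i j, A i j ∈ X hp)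
    (hB : ∀ i j, B i j ∈ X hp) (i j : m) : (A * B) i j ∈ X hp := by
  rw [Matrix.mul_apply]
  exact sum_mem_X hp _ _ fun k _ => mul_mem_X hp (hA i k) (hB k j)

omit [Fintype m] [DecidableEq m] in
/-- Sums / differences / `1` / `γ`-images of matrices over `X` are over `X`. [folklore] -/
private theorem add_apply_mem_X {A B : Matrix m m (CompletedAlgClosure F)} (hA : ∀ i j, A i j ∈ X hp)
    (hB : ∀ i j, B i j ∈ X hp) (i j : m) : (A + B) i j ∈ X hp := by
  rw [Matrix.add_apply]; exact add_mem_X hp (hA i j) (hB i j)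

omit [Fintype m] [DecidableEq m] in
/-- see `add_apply_mem_X`. [folklore] -/
private theorem sub_apply_mem_X {A B : Matrix m m (CompletedAlgClosure F)} (hA : ∀ i j, A i j ∈ X hp)
    (hB : ∀ i j, B i j ∈ X hp) (i j : m) : (A - B) i j ∈ X hp := by
  rw [Matrix.sub_apply]; exact sub_mem_X hp (hA i j) (hB i j)

omit [Fintype m] in
/-- see `add_apply_mem_X`. [folklore] -/
private theorem one_apply_mem_X (i j : m) : (1 : Matrix m m (CompletedAlgClosure F)) i j ∈ X hp := by
  rw [Matrix.one_apply]
  split_ifs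
  · exact one_mem_X hp
  · exact zero_mem_X hp

omit [Fintype m] [DecidableEq m] in
/-- see `add_apply_mem_X`. [folklore] -/
private theorem map_smul_apply_mem_X (g : BaseGaloisGroup hp) {A : Matrix m m (CompletedAlgClosure F)}
    (hA : ∀ i j, A i j ∈ X hp) (i j : m) : (A.map fun x => g • x) i j ∈ X hp := by
  rw [Matrix.map_apply]; exact smul_mem_X hp g (hA i j)

/-- The inverse of a matrix over the subfield `X` is over `X` (adjugate and determinant are
polynomials in the entries). [folklore] -/
private theorem inv_apply_mem_X {A : Matrix m m (CompletedAlgClosure F)} (hA : ∀ i j, A i j ∈ X hp)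
    (i j : m) : A⁻¹ i j ∈ X hp := by
  obtain ⟨R, hR⟩ := exists_subring_coe_eq_X hp
  have hmem : ∀ i j, A i j ∈ R := fun i j => by rw [← SetLike.mem_coe, hR]; exact hA i j
  set A' : Matrix m m R := fun i j => ⟨A i j, hmem i j⟩ with hA'
  have hAA' : R.subtype.mapMatrix A' = A := by
    ext i j; rfl
  have hdet : A.det ∈ X hp := by
    rw [← hR, SetLike.mem_coe, ← hAA', ← RingHom.map_det]
    exact (A'.det).2
  have hadj : A.adjugate i j ∈ X hp := by
    rw [← hR, SetLike.mem_coe, ← hAA', ← RingHom.map_adjugate]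
    exact (A'.adjugate i j).2
  rw [Matrix.inv_def, Matrix.smul_apply, smul_eq_mul, Ring.inverse_eq_inv]
  exact mul_mem_X hp (inv_mem_X hp hdet) hadj

/-! ### The contraction step (Berger–Colmez, Lemme 3.2.3) -/

/-- **Berger–Colmez, Lemme 3.2.3 (cyclotomic tower, `Λ̃ = ℂ_F`): one step of the decompletion.**
`U ∈ M_d(X)`, `Rr ∈ M_d(X)^{γ=1}` with `‖Rr‖ ≤ M`, `‖U − 1 − Rr‖ ≤ E`, `‖p‖⁻¹E ≤ M`, `‖p‖⁻³E < 1`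
(entrywise sup norms, `γ = γ_n`, `n ≥ 2`). Then there are `C ∈ M_d(X)` with `‖C‖ ≤ ‖p‖⁻³ E` and a
`γ`-fixed `Rr' ∈ M_d(X)` with `‖Rr'‖ ≤ M`, `‖Rr' − Rr‖ ≤ ‖p‖⁻¹E`, such that
`U' = (1 + C)⁻¹ U γ(1 + C) ∈ M_d(X)` and `‖U' − 1 − Rr'‖ ≤ ‖p‖⁻³ M E`. (The constants: Colmez's
`c₂ = 1`, `c₃ = 2` from Tate's Prop. 6 / Prop. 7.)
[cite: BergerColmez2008, Lemme 3.2.3] [cite: Tate1967, §3.2 Prop. 7] -/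
theorem exists_conj_near_fixed_matrix {n : ℕ} (hn : 2 ≤ n) {U Rr : Matrix m m (CompletedAlgClosure F)}
    (hU : ∀ i j, U i j ∈ X hp) (hRr : ∀ i j, Rr i j ∈ X hp) (hγRr : ∀ i j, gen hp n • Rr i j = Rr i j)
    {M E : ℝ} (hRrM : ∀ i j, ‖Rr i j‖ ≤ M) (hEM : ‖(p : PadicBase F p hp)‖⁻¹ * E ≤ M)
    (hE3 : ‖(p : PadicBase F p hp)‖⁻¹ ^ 3 * E < 1) (hE : ∀ i j, ‖(U - 1 - Rr) i j‖ ≤ E) :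
    ∃ C : Matrix m m (CompletedAlgClosure F), (∀ i j, C i j ∈ X hp) ∧
      (∀ i j, ‖C i j‖ ≤ ‖(p : PadicBase F p hp)‖⁻¹ ^ 3 * E) ∧
      ∃ Rr' : Matrix m m (CompletedAlgClosure F), (∀ i j, Rr' i j ∈ X hp) ∧
        (∀ i j, gen hp n • Rr' i j = Rr' i j) ∧ (∀ i j, ‖Rr' i j‖ ≤ M) ∧
        (∀ i j, ‖(Rr' - Rr) i j‖ ≤ ‖(p : PadicBase F p hp)‖⁻¹ * E) ∧
        (∀ i j, ((1 + C)⁻¹ * U * (1 + C.map fun x => gen hp n • x)) i j ∈ X hp) ∧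
        ∀ i j, ‖((1 + C)⁻¹ * U * (1 + C.map fun x => gen hp n • x) - 1 - Rr') i j‖ ≤
          ‖(p : PadicBase F p hp)‖⁻¹ ^ 3 * M * E := by
  set π : ℝ := ‖(p : PadicBase F p hp)‖ with hπ
  have hπ0 : 0 < π := norm_pos_iff.mpr (by exact_mod_cast (Fact.out : p.Prime).ne_zero)
  have hπ1 : π < 1 := PadicBase.norm_p_lt_one hp
  have hπi1 : 1 ≤ π⁻¹ := one_le_inv_iff₀.mpr ⟨hπ0, hπ1.le⟩
  have hπi0 : 0 ≤ π⁻¹ := le_trans zero_le_one hπi1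
  rcases isEmpty_or_nonempty m with hm | ⟨⟨i₀⟩⟩
  · -- no entries: everything is vacuous
    exact ⟨0, fun i => isEmptyElim i, fun i => isEmptyElim i, 0, fun i => isEmptyElim i,
      fun i => isEmptyElim i, fun i => isEmptyElim i, fun i => isEmptyElim i, fun i => isEmptyElim i,
      fun i => isEmptyElim i⟩
  have hE0 : 0 ≤ E := (norm_nonneg _).trans (hE i₀ i₀)
  have hEE : E ≤ π⁻¹ * E := le_mul_of_one_le_left hE0 hπi1
  have hEM' : E ≤ M := hEE.trans hEM
  have hM0 : 0 ≤ M := (norm_nonneg _).trans (hRrM i₀ i₀)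
  -- the data `W = U − 1 − Rr`, `Rw = R_n(W)`, `V₁ = W − Rw`
  have hW : ∀ i j, (U - 1 - Rr) i j ∈ X hp :=
    sub_apply_mem_X hp (sub_apply_mem_X hp hU (one_apply_mem_X hp)) hRr
  set Rw : Matrix m m (CompletedAlgClosure F) := fun i j => Rhat hp n ⟨(U - 1 - Rr) i j, hW i j⟩
    with hRw_def
  have hRw_apply : ∀ i j, Rw i j = Rhat hp n ⟨(U - 1 - Rr) i j, hW i j⟩ := fun i j => rfl
  have hRwX : ∀ i j, Rw i j ∈ X hp := fun i j => by rw [hRw_apply]; exact Rhat_mem_X hp hn _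
  have hγRw : ∀ i j, gen hp n • Rw i j = Rw i j := fun i j => by
    rw [hRw_apply]; exact gen_smul_Rhat hp hn _
  have hRw_norm : ∀ i j, ‖Rw i j‖ ≤ π⁻¹ * E := fun i j => by
    rw [hRw_apply]
    exact (norm_Rhat_le hp hn _).trans (mul_le_mul_of_nonneg_left (hE i j) hπi0)
  have hV₁X : ∀ i j, (U - 1 - Rr - Rw) i j ∈ X hp := sub_apply_mem_X hp hW hRwX
  have hRV₁ : ∀ i j, Rhat hp n ⟨(U - 1 - Rr - Rw) i j, hV₁X i j⟩ = 0 := by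
    intro i j
    have hsub : (U - 1 - Rr - Rw) i j = (U - 1 - Rr) i j - Rw i j := Matrix.sub_apply _ _ _ _
    have h := Rhat_sub hp hn ⟨(U - 1 - Rr) i j, hW i j⟩ ⟨Rw i j, hRwX i j⟩
    have h2 : Rhat hp n ⟨Rw i j, hRwX i j⟩ = Rw i j := Rhat_Rhat hp hn ⟨(U - 1 - Rr) i j, hW i j⟩
    have h3 : (⟨(U - 1 - Rr - Rw) i j, hV₁X i j⟩ : X hp) =
        ⟨(U - 1 - Rr) i j - Rw i j, sub_mem_X hp (hW i j) (hRwX i j)⟩ := Subtype.ext hsub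
    rw [h3, h, h2, hRw_apply, sub_self]
  have hV₁norm : ∀ i j, ‖(U - 1 - Rr - Rw) i j‖ ≤ π⁻¹ * E := fun i j =>
    (norm_sub_apply_le hE hRw_norm i j).trans (max_le hEE le_rfl)
  -- Tate's Prop. 7, entrywise: `γ c' − c' = V₁`, `R c' = 0`, `‖c'‖ ≤ π⁻³ E`
  choose c' hc'X hRc' hc'eq using
    fun i j => exists_gen_smul_sub_eq_of_Rhat_eq_zero hp hn (hV₁X i j) (hRV₁ i j)
  have hc'norm : ∀ i j, ‖c' i j‖ ≤ π⁻¹ ^ 3 * E := by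
    intro i j
    have h := norm_sub_Rhat_le hp hn ⟨c' i j, hc'X i j⟩
    simp only [hRc', sub_zero] at h
    rw [hc'eq] at h
    refine h.trans ?_
    calc π⁻¹ ^ 2 * ‖(U - 1 - Rr - Rw) i j‖ ≤ π⁻¹ ^ 2 * (π⁻¹ * E) :=
          mul_le_mul_of_nonneg_left (hV₁norm i j) (pow_nonneg hπi0 2)
      _ = π⁻¹ ^ 3 * E := by ring
  -- `C = −c'`, `Rr' = Rr + Rw`
  set C : Matrix m m (CompletedAlgClosure F) := fun i j => -c' i j with hC_def
  have hC_apply : ∀ i j, C i j = -c' i j := fun i j => rfl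
  have hCX : ∀ i j, C i j ∈ X hp := fun i j => by rw [hC_apply]; exact neg_mem_X hp (hc'X i j)
  have hCn : ∀ i j, ‖C i j‖ ≤ π⁻¹ ^ 3 * E := fun i j => by rw [hC_apply, norm_neg]; exact hc'norm i j
  have hr30 : 0 ≤ π⁻¹ ^ 3 * E := mul_nonneg (pow_nonneg hπi0 3) hE0
  have hCγX : ∀ i j, (C.map fun x => gen hp n • x) i j ∈ X hp := map_smul_apply_mem_X hp _ hCX
  have hCγn : ∀ i j, ‖(C.map fun x => gen hp n • x) i j‖ ≤ π⁻¹ ^ 3 * E := fun i j => by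
    rw [Matrix.map_apply, CompletedAlgClosure.norm_base_smul hp]; exact hCn i j
  have hRr'X : ∀ i j, (Rr + Rw) i j ∈ X hp := add_apply_mem_X hp hRr hRwX
  have hγRr' : ∀ i j, gen hp n • (Rr + Rw) i j = (Rr + Rw) i j := fun i j => by
    rw [Matrix.add_apply, smul_add, hγRr, hγRw]
  have hRr'M : ∀ i j, ‖(Rr + Rw) i j‖ ≤ M := fun i j =>
    (norm_add_apply_le hRrM hRw_norm i j).trans (max_le le_rfl hEM)
  have hdet : IsUnit (1 + C : Matrix m m (CompletedAlgClosure F)).det := by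
    refine isUnit_det_of_norm_sub_one_le hr30 hE3 (B := 1 + C) fun i j => ?_
    rw [add_sub_cancel_left]; exact hCn i j
  refine ⟨C, hCX, hCn, Rr + Rw, hRr'X, hγRr', hRr'M, fun i j => ?_, ?_, ?_⟩
  · rw [add_sub_cancel_left]; exact hRw_norm i j
  · -- membership in `M_d(X)`
    exact mul_apply_mem_X hp (mul_apply_mem_X hp (inv_apply_mem_X hp (add_apply_mem_X hp
      (one_apply_mem_X hp) hCX)) hU) (add_apply_mem_X hp (one_apply_mem_X hp) hCγX)
  -- the exact identity `(1 + C)(U' − 1 − Rr') = V γ(C) − C Rr'`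
  have hγC : (C.map fun x => gen hp n • x) = C - (U - 1 - Rr - Rw) := by
    ext i j
    rw [Matrix.map_apply, Matrix.sub_apply, hC_apply, smul_neg, ← hc'eq i j]
    ring
  have hid : (1 + C)⁻¹ * U * (1 + C.map fun x => gen hp n • x) - 1 - (Rr + Rw) =
      (1 + C)⁻¹ * ((U - 1) * (C.map fun x => gen hp n • x) - C * (Rr + Rw)) := by
    have h1 : (1 + C)⁻¹ * U * (1 + C.map fun x => gen hp n • x) - 1 - (Rr + Rw) =
        (1 + C)⁻¹ * ((1 + C) * ((1 + C)⁻¹ * U * (1 + C.map fun x => gen hp n • x) - 1 - (Rr + Rw))) :=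
      (Matrix.nonsing_inv_mul_cancel_left (1 + C) _ hdet).symm
    rw [h1]
    congr 1
    have h2 : (1 + C) * ((1 + C)⁻¹ * U * (1 + C.map fun x => gen hp n • x)) =
        U * (1 + C.map fun x => gen hp n • x) := by
      rw [Matrix.mul_assoc, Matrix.mul_nonsing_inv_cancel_left (1 + C) _ hdet]
    rw [Matrix.mul_sub, Matrix.mul_sub, h2, hγC]
    noncomm_ring
  intro i j
  rw [hid]
  have hV : ∀ i j, ‖(U - 1) i j‖ ≤ M := by
    intro i j
    have h : (U - 1) i j = (U - 1 - Rr) i j + Rr i j := by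
      rw [Matrix.sub_apply (U - 1) Rr, sub_add_cancel]
    rw [h]
    exact (norm_add_le_max' _ _).trans (max_le ((hE i j).trans hEM') (hRrM i j))
  have hinner : ∀ i j, ‖((U - 1) * (C.map fun x => gen hp n • x) - C * (Rr + Rw)) i j‖ ≤
      π⁻¹ ^ 3 * M * E := by
    intro i j
    refine (norm_sub_apply_le (norm_mul_apply_le hM0 hr30 hV hCγn) (norm_mul_apply_le hr30 hM0 hCn hRr'M)
      i j).trans (max_le (le_of_eq (by ring)) (le_of_eq (by ring)))
  calc ‖((1 + C)⁻¹ * ((U - 1) * (C.map fun x => gen hp n • x) - C * (Rr + Rw))) i j‖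
        ≤ 1 * (π⁻¹ ^ 3 * M * E) :=
        norm_mul_apply_le zero_le_one (mul_nonneg (mul_nonneg (pow_nonneg hπi0 3) hM0) hE0)
          (norm_inv_one_add_apply_le hr30 hE3 hCn) hinner i j
    _ = π⁻¹ ^ 3 * M * E := one_mul _

/-! ### The decompletion theorem (Berger–Colmez, Cor. 3.2.4) -/

/-- `‖γ y − y‖ ≤ ‖y‖` (`γ` is an isometry of `ℂ_F`). [folklore] -/
private theorem norm_gen_smul_sub_le' (n : ℕ) (y : CompletedAlgClosure F) :
    ‖gen hp n • y - y‖ ≤ ‖y‖ := by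
  refine (norm_sub_le_max' _ _).trans (max_le (le_of_eq ?_) le_rfl)
  exact CompletedAlgClosure.norm_base_smul hp (gen hp n) y

omit [Fintype m] in
/-- `γ` fixes the entries of the identity matrix. [folklore] -/
private theorem smul_one_apply (g : BaseGaloisGroup hp) (i j : m) :
    g • (1 : Matrix m m (CompletedAlgClosure F)) i j = (1 : Matrix m m (CompletedAlgClosure F)) i j := by
  rw [Matrix.one_apply]
  split_ifs
  · exact smul_one g
  · exact smul_zero g

omit [CharZero F] in
/-- `(B(1+C))⁻¹ · U · f(B(1+C)) = (1+C)⁻¹ · (B⁻¹ U f(B)) · (1 + f(C))` for a ring endomorphism `f`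
applied entrywise. [folklore] -/
private theorem conj_mul_one_add (f : CompletedAlgClosure F →+* CompletedAlgClosure F)
    (U B C : Matrix m m (CompletedAlgClosure F)) :
    (B * (1 + C))⁻¹ * U * (B * (1 + C)).map f = (1 + C)⁻¹ * (B⁻¹ * U * B.map f) * (1 + C.map f) := by
  rw [Matrix.mul_inv_rev, Matrix.map_mul, Matrix.map_add f (map_add f),
    Matrix.map_one f (map_zero f) (map_one f)]
  simp only [Matrix.mul_assoc]

/-- ★ **Berger–Colmez, Cor. 3.2.4 (cyclotomic tower, `Λ̃ = ℂ_F`): decompletion of small cocycles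
for `GL_d`.** Let `n ≥ 2`, `γ = γ_n`, and let `U ∈ M_d(X)` with `‖U − 1‖ ≤ ‖p‖⁷` (entrywise). Then
there is `B ∈ M_d(X)` with `‖B − 1‖ ≤ ‖p‖² < 1`, `det B` a unit and `B⁻¹ ∈ M_d(X)` (so `B ∈ GL_d(X)`)
such that `B⁻¹ · U · γ(B) ∈ M_d(X)` is fixed by `γ` entrywise. Proof: successive
approximation by the contraction step `exists_conj_near_fixed_matrix`, convergence of the products
`B_k = (1 + C₀)⋯(1 + C_{k−1})` in the complete field `ℂ_F` (entrywise) with `X` closed, and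
continuity of matrix inversion at the invertible limit.
[cite: BergerColmez2008, Cor. 3.2.4] [cite: Tate1967, §3.2 Prop. 7] -/
theorem exists_matrix_conj_fixed {n : ℕ} (hn : 2 ≤ n) {U : Matrix m m (CompletedAlgClosure F)}
    (hU : ∀ i j, U i j ∈ X hp) (hU1 : ∀ i j, ‖(U - 1) i j‖ ≤ ‖(p : PadicBase F p hp)‖ ^ 7) :
    ∃ B : Matrix m m (CompletedAlgClosure F), (∀ i j, B i j ∈ X hp) ∧
      (∀ i j, ‖(B - 1) i j‖ ≤ ‖(p : PadicBase F p hp)‖ ^ 2) ∧ IsUnit B.det ∧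
      (∀ i j, B⁻¹ i j ∈ X hp) ∧
      (∀ i j, (B⁻¹ * U * B.map fun x => gen hp n • x) i j ∈ X hp) ∧
      ∀ i j, gen hp n • (B⁻¹ * U * B.map fun x => gen hp n • x) i j =
        (B⁻¹ * U * B.map fun x => gen hp n • x) i j := by
  set π : ℝ := ‖(p : PadicBase F p hp)‖ with hπ
  have hπ0 : 0 < π := norm_pos_iff.mpr (by exact_mod_cast (Fact.out : p.Prime).ne_zero)
  have hπ1 : π < 1 := PadicBase.norm_p_lt_one hp
  have hπne : π ≠ 0 := hπ0.ne'
  have hπle1 : π ≤ 1 := hπ1.le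
  have hπi1 : 1 ≤ π⁻¹ := one_le_inv_iff₀.mpr ⟨hπ0, hπ1.le⟩
  have hπi0 : 0 ≤ π⁻¹ := le_trans zero_le_one hπi1
  have hπ2 : π ^ 2 < 1 := pow_lt_one₀ hπ0.le hπ1 two_ne_zero
  have hπpow : ∀ {a b : ℕ}, a ≤ b → π ^ b ≤ π ^ a := fun h => pow_le_pow_of_le_one hπ0.le hπle1 h
  -- the entrywise action of `γ` as a ring endomorphism
  set f : CompletedAlgClosure F →+* CompletedAlgClosure F :=
    MulSemiringAction.toRingHom (BaseGaloisGroup hp) (CompletedAlgClosure F) (gen hp n) with hf_def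
  have hf : (fun x : CompletedAlgClosure F => gen hp n • x) = ⇑f := by
    funext x; simp [hf_def]
  have hγcont : Continuous (f : CompletedAlgClosure F → CompletedAlgClosure F) := by
    rw [← hf]; exact CompletedAlgClosure.continuous_base_smul hp (gen hp n)
  rw [hf]
  -- `U_B = B⁻¹ U γ(B)` has entries in `X` as soon as `B` does
  have hUB : ∀ B : Matrix m m (CompletedAlgClosure F), (∀ i j, B i j ∈ X hp) →
      ∀ i j, (B⁻¹ * U * B.map f) i j ∈ X hp := fun B hB =>
    mul_apply_mem_X hp (mul_apply_mem_X hp (inv_apply_mem_X hp hB) hU)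
      (by rw [← hf]; exact map_smul_apply_mem_X hp _ hB)
  -- `‖B‖ ≤ 1` when `‖B − 1‖ ≤ π²`
  have hBle1 : ∀ B : Matrix m m (CompletedAlgClosure F), (∀ i j, ‖(B - 1) i j‖ ≤ π ^ 2) →
      ∀ i j, ‖B i j‖ ≤ 1 := by
    intro B hB i j
    have h := (norm_one_add_apply_le hπ2.le hB i j).1
    rwa [add_sub_cancel] at h
  -- the invariant of the iteration, on states `(B, Rr)`
  let I : ℕ → Matrix m m (CompletedAlgClosure F) × Matrix m m (CompletedAlgClosure F) → Prop :=
    fun k s => (∀ i j, s.1 i j ∈ X hp) ∧ (∀ i j, ‖(s.1 - 1) i j‖ ≤ π ^ 2) ∧ (∀ i j, s.2 i j ∈ X hp) ∧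
      (∀ i j, gen hp n • s.2 i j = s.2 i j) ∧ (∀ i j, ‖s.2 i j‖ ≤ π ^ 4) ∧
      ∀ i j, ‖(s.1⁻¹ * U * s.1.map f - 1 - s.2) i j‖ ≤ π ^ 5 * π ^ k
  -- the step
  have hstep : ∀ k (s : Matrix m m (CompletedAlgClosure F) × Matrix m m (CompletedAlgClosure F)),
      I k s → ∃ s' : Matrix m m (CompletedAlgClosure F) × Matrix m m (CompletedAlgClosure F),
        I (k + 1) s' ∧ ∀ i j, ‖(s'.1 - s.1) i j‖ ≤ π ^ 2 * π ^ k := by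
    rintro k ⟨B, Rr⟩ ⟨hBX, hB1, hRrX, hγRr, hRr4, hE⟩
    simp only at hBX hB1 hRrX hγRr hRr4 hE
    have hπk0 : 0 ≤ π ^ k := pow_nonneg hπ0.le k
    have hπk1 : π ^ k ≤ 1 := pow_le_one₀ hπ0.le hπle1
    have hEM : π⁻¹ * (π ^ 5 * π ^ k) ≤ π ^ 4 := by
      have h : π⁻¹ * (π ^ 5 * π ^ k) = π ^ 4 * π ^ k := by field_simp
      rw [h]; exact mul_le_of_le_one_right (pow_nonneg hπ0.le 4) hπk1
    have hE3 : π⁻¹ ^ 3 * (π ^ 5 * π ^ k) < 1 := by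
      have h : π⁻¹ ^ 3 * (π ^ 5 * π ^ k) = π ^ 2 * π ^ k := by field_simp
      rw [h]
      calc π ^ 2 * π ^ k ≤ π ^ 2 * 1 := mul_le_mul_of_nonneg_left hπk1 (pow_nonneg hπ0.le 2)
        _ < 1 := by rw [mul_one]; exact hπ2
    obtain ⟨C, hCX, hCn, Rr', hRr'X, hγRr', hRr'4, -, -, hE'⟩ :=
      exists_conj_near_fixed_matrix hp hn (hUB B hBX) hRrX hγRr hRr4 hEM hE3 hE
    rw [← hπ] at hCn hE'
    rw [hf] at hE'
    have hCn' : ∀ i j, ‖C i j‖ ≤ π ^ 2 * π ^ k := fun i j =>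
      (hCn i j).trans (le_of_eq (by field_simp))
    have hC2 : ∀ i j, ‖C i j‖ ≤ π ^ 2 := fun i j =>
      (hCn' i j).trans (mul_le_of_le_one_right (pow_nonneg hπ0.le 2) hπk1)
    have hBn : ∀ i j, ‖B i j‖ ≤ 1 := hBle1 B hB1
    have hBC : ∀ i j, ‖(B * C) i j‖ ≤ π ^ 2 * π ^ k := fun i j =>
      (norm_mul_apply_le zero_le_one (mul_nonneg (pow_nonneg hπ0.le 2) hπk0) hBn hCn' i j).trans
        (le_of_eq (one_mul _))
    refine ⟨⟨B * (1 + C), Rr'⟩, ⟨?_, ?_, hRr'X, hγRr', hRr'4, ?_⟩, ?_⟩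
    · exact mul_apply_mem_X hp hBX (add_apply_mem_X hp (one_apply_mem_X hp) hCX)
    · -- `‖B(1+C) − 1‖ ≤ π²`
      intro i j
      have h : B * (1 + C) - 1 = (B - 1) + B * C := by noncomm_ring
      simp only
      rw [h]
      exact (norm_add_apply_le hB1 hBC i j).trans
        (max_le le_rfl (mul_le_of_le_one_right (pow_nonneg hπ0.le 2) hπk1))
    · intro i j
      simp only
      rw [conj_mul_one_add f U B C]
      refine (hE' i j).trans (le_of_eq ?_)
      rw [pow_succ]; field_simp; ring
    · -- `‖B(1+C) − B‖ = ‖B C‖ ≤ π² πᵏ`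
      intro i j
      simp only
      have h : B * (1 + C) - B = B * C := by noncomm_ring
      rw [h]; exact hBC i j
  -- the initial state `(1, R_n(U − 1))`
  have hV0 : ∀ i j, (U - 1) i j ∈ X hp := sub_apply_mem_X hp hU (one_apply_mem_X hp)
  set Rw₀ : Matrix m m (CompletedAlgClosure F) := fun i j => Rhat hp n ⟨(U - 1) i j, hV0 i j⟩
    with hRw₀_def
  have hRw₀_apply : ∀ i j, Rw₀ i j = Rhat hp n ⟨(U - 1) i j, hV0 i j⟩ := fun i j => rfl
  have hI0 : I 0 ⟨1, Rw₀⟩ := by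
    refine ⟨one_apply_mem_X hp, fun i j => ?_, fun i j => ?_, fun i j => ?_, fun i j => ?_, fun i j => ?_⟩
    · simp only
      rw [sub_self, Matrix.zero_apply, norm_zero]; exact pow_nonneg hπ0.le 2
    · simp only
      rw [hRw₀_apply]; exact Rhat_mem_X hp hn _
    · simp only
      rw [hRw₀_apply]; exact gen_smul_Rhat hp hn _
    · simp only
      rw [hRw₀_apply]
      refine (norm_Rhat_le hp hn _).trans ?_
      rw [← hπ]
      calc π⁻¹ * ‖(U - 1) i j‖ ≤ π⁻¹ * π ^ 7 := mul_le_mul_of_nonneg_left (hU1 i j) hπi0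
        _ = π ^ 6 := by field_simp
        _ ≤ π ^ 4 := hπpow (by norm_num)
    · simp only
      rw [inv_one, one_mul, Matrix.map_one f (map_zero f) (map_one f), mul_one, pow_zero, mul_one,
        Matrix.sub_apply (U - 1) Rw₀, hRw₀_apply]
      refine (norm_sub_Rhat_le hp hn ⟨(U - 1) i j, hV0 i j⟩).trans ?_
      rw [← hπ]
      calc π⁻¹ ^ 2 * ‖gen hp n • (U - 1) i j - (U - 1) i j‖ ≤ π⁻¹ ^ 2 * π ^ 7 :=
            mul_le_mul_of_nonneg_left ((norm_gen_smul_sub_le' hp n _).trans (hU1 i j))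
              (pow_nonneg hπi0 2)
        _ = π ^ 5 := by field_simp
  -- run the iteration
  choose! next hnext using hstep
  obtain ⟨seq, hseq0, hseqS⟩ : ∃ seq : ℕ → Matrix m m (CompletedAlgClosure F) ×
      Matrix m m (CompletedAlgClosure F), seq 0 = ⟨1, Rw₀⟩ ∧ ∀ k, seq (k + 1) = next k (seq k) :=
    ⟨fun k => Nat.rec ⟨1, Rw₀⟩ (fun k s => next k s) k, rfl, fun _ => rfl⟩
  have hI : ∀ k, I k (seq k) := by
    intro k
    induction k with
    | zero => rw [hseq0]; exact hI0
    | succ k ih => rw [hseqS]; exact (hnext k _ ih).1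
  have hdist : ∀ i j k, dist ((seq k).1 i j) ((seq (k + 1)).1 i j) ≤ π ^ 2 * π ^ k := by
    intro i j k
    rw [dist_comm, dist_eq_norm, hseqS, ← Matrix.sub_apply]
    exact (hnext k _ (hI k)).2 i j
  -- entrywise limits, assembled into a matrix limit
  choose Bl hBl using fun i j =>
    cauchySeq_tendsto_of_complete (cauchySeq_of_le_geometric π (π ^ 2) hπ1 (hdist i j))
  set B : Matrix m m (CompletedAlgClosure F) := fun i j => Bl i j with hB_def
  have hB_apply : ∀ i j, B i j = Bl i j := fun i j => rfl
  have hB : Tendsto (fun k => (seq k).1) atTop (𝓝 B) :=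
    tendsto_pi_nhds.mpr fun i => tendsto_pi_nhds.mpr fun j => hBl i j
  -- the limit `B ∈ M_d(X)`, `‖B − 1‖ ≤ π² < 1`
  have hBX : ∀ i j, B i j ∈ X hp := fun i j =>
    (isClosed_X hp).mem_of_tendsto (hBl i j) (Eventually.of_forall fun k => (hI k).1 i j)
  have hB1 : ∀ i j, ‖(B - 1) i j‖ ≤ π ^ 2 := by
    intro i j
    rw [Matrix.sub_apply]
    refine le_of_tendsto ((continuous_norm.tendsto _).comp
      ((hBl i j).sub_const ((1 : Matrix m m (CompletedAlgClosure F)) i j)))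
      (Eventually.of_forall fun k => ?_)
    have h := (hI k).2.1 i j
    rwa [Matrix.sub_apply] at h
  have hdetB : IsUnit B.det := isUnit_det_of_norm_sub_one_le (pow_nonneg hπ0.le 2) hπ2 hB1
  -- `U_k = B_k⁻¹ U γ(B_k) → B⁻¹ U γ(B)`
  have hinvcont : ContinuousAt Ring.inverse B.det := by
    obtain ⟨u, hu⟩ := hdetB
    rw [← hu]; exact NormedRing.inverse_continuousAt u
  have hBinv : Tendsto (fun k => ((seq k).1)⁻¹) atTop (𝓝 B⁻¹) :=
    ((continuousAt_matrix_inv B hinvcont).tendsto).comp hB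
  have hBmap : Tendsto (fun k => ((seq k).1).map f) atTop (𝓝 (B.map f)) :=
    ((continuous_id.matrix_map hγcont).tendsto B).comp hB
  have hUk : Tendsto (fun k => ((seq k).1)⁻¹ * U * ((seq k).1).map f) atTop
      (𝓝 (B⁻¹ * U * B.map f)) := (hBinv.mul tendsto_const_nhds).mul hBmap
  refine ⟨B, hBX, hB1, hdetB, inv_apply_mem_X hp hBX, hUB B hBX, fun i j => ?_⟩
  have hUij : Tendsto (fun k => (((seq k).1)⁻¹ * U * ((seq k).1).map f) i j) atTop
      (𝓝 ((B⁻¹ * U * B.map f) i j)) := tendsto_pi_nhds.mp (tendsto_pi_nhds.mp hUk i) j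
  -- `‖γ (U_k)_{ij} − (U_k)_{ij}‖ ≤ π⁵ πᵏ → 0`, hence `γ` fixes the limit entry
  have hsmall : ∀ k, ‖gen hp n • (((seq k).1)⁻¹ * U * ((seq k).1).map f) i j -
      (((seq k).1)⁻¹ * U * ((seq k).1).map f) i j‖ ≤ π ^ 5 * π ^ k := by
    intro k
    obtain ⟨-, -, -, hγr, -, hE⟩ := hI k
    set V := ((seq k).1)⁻¹ * U * ((seq k).1).map f
    have hVij : V i j = (V - 1 - (seq k).2) i j + (1 : Matrix m m (CompletedAlgClosure F)) i j +
        (seq k).2 i j := by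
      rw [Matrix.sub_apply, Matrix.sub_apply]; ring
    have h : gen hp n • V i j - V i j =
        gen hp n • (V - 1 - (seq k).2) i j - (V - 1 - (seq k).2) i j := by
      rw [hVij, smul_add, smul_add, smul_one_apply hp, hγr]; ring
    rw [h]
    exact (norm_gen_smul_sub_le' hp n _).trans (hE i j)
  have hlim0 : Tendsto (fun k => gen hp n • (((seq k).1)⁻¹ * U * ((seq k).1).map f) i j -
      (((seq k).1)⁻¹ * U * ((seq k).1).map f) i j) atTop (𝓝 0) := by
    refine squeeze_zero_norm hsmall ?_
    have h := (tendsto_pow_atTop_nhds_zero_of_lt_one hπ0.le hπ1).const_mul (π ^ 5)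
    rw [mul_zero] at h
    exact h
  have hγcont' : Continuous fun z : CompletedAlgClosure F => gen hp n • z :=
    CompletedAlgClosure.continuous_base_smul hp (gen hp n)
  have hlim1 : Tendsto (fun k => gen hp n • (((seq k).1)⁻¹ * U * ((seq k).1).map f) i j -
      (((seq k).1)⁻¹ * U * ((seq k).1).map f) i j) atTop
      (𝓝 (gen hp n • (B⁻¹ * U * B.map f) i j - (B⁻¹ * U * B.map f) i j)) :=
    ((hγcont'.tendsto _).comp hUij).sub hUij
  exact sub_eq_zero.mp (tendsto_nhds_unique hlim1 hlim0)

/-- ★ **Corollary: small cocycles come from `GL_d(K_n)`.** For `n ≥ 2` and `U ∈ M_d(X)` with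
`‖U − 1‖ ≤ ‖p‖⁷` there is `B ∈ GL_d(X)` (`‖B − 1‖ ≤ ‖p‖²`) and `W ∈ M_d(K_n)` (entries in the image
of `K n = K₀(ζ_{pⁿ})` in `ℂ_F`) with `U · γ_n(B) = B · W`, i.e. `U = B · W · γ_n(B)⁻¹`: the
`γ_n`-invariants of `X` are `K_n` (`mem_image_K_of_gen_smul_eq`, Tate).
[cite: BergerColmez2008, Cor. 3.2.4] [cite: Tate1967, §3.2 Prop. 7] -/
theorem exists_matrix_K_mul_eq {n : ℕ} (hn : 2 ≤ n) {U : Matrix m m (CompletedAlgClosure F)}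
    (hU : ∀ i j, U i j ∈ X hp) (hU1 : ∀ i j, ‖(U - 1) i j‖ ≤ ‖(p : PadicBase F p hp)‖ ^ 7) :
    ∃ B : Matrix m m (CompletedAlgClosure F), (∀ i j, B i j ∈ X hp) ∧
      (∀ i j, ‖(B - 1) i j‖ ≤ ‖(p : PadicBase F p hp)‖ ^ 2) ∧ IsUnit B.det ∧
      ∃ W : Matrix m m (CompletedAlgClosure F),
        (∀ i j, W i j ∈ ((↑) : NormedAlgClosure F → CompletedAlgClosure F) ''
          (K hp n : Set (NormedAlgClosure F))) ∧
        U * (B.map fun x => gen hp n • x) = B * W := by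
  obtain ⟨B, hBX, hB1, hdet, -, hWX, hγW⟩ := exists_matrix_conj_fixed hp hn hU hU1
  refine ⟨B, hBX, hB1, hdet, B⁻¹ * U * B.map (fun x => gen hp n • x), fun i j =>
    mem_image_K_of_gen_smul_eq hp hn (hWX i j) (hγW i j), ?_⟩
  rw [Matrix.mul_assoc, Matrix.mul_nonsing_inv_cancel_left B _ hdet]

end TateTrace

end Literature.NumberTheory.PAdicHodge
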